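import Mathlib
import HarnessLib
import Summits.HubbardSuperconductivity.HubbardSuperconductivity.Theorems.KLProgrammeKLRegimeFatMultiplierIncrementRelJetsScaleData

/-!
# Route `KLProgramme` — crux K3 ENGINE (stmt-HubbardSuperconductivity-20437) stub (b) conj. 2 «(c-D)² FAMILY TELESCOPE», brick (D5-prep 3b): the increment
# pair's SPACE Leibniz difference bounds in RELATIVE SCALE FORM — `‖Δ^k Gs‖ ≤ 𝔅₀·η^k·R̃_k(x)` with `R̃_k` of degree `k` in the depth `x`

Cell `gate-hubbard-kl`, seat hubbard-kl-k3c3-p2 (g11); F1-DESIGN §8/§10, feeding `slicePairWt_charSum_l1_le_famIncrScale` (`…SectorSlicePairFamIncrScale`).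
Composition of `incrPair_W_rel_le`, `incrPair_B_rel_le` (`…IncrementRelJets`), `incrPair_lineData_scale_le'` (`…IncrementRelJetsScaleData`) and
`incrPair_relJets_scale_le` (`…IncrementRelJetsTwoScale`) with the co-factor's scale-form jets:

* **`incrPair_space_rel_scale_le`** — from the instance's Leibniz bounds `n_k ≤ Σ binom 𝔅_j q_{k−j}` (exact brackets), the inequality line data of the
  scale class and `q_k ≤ η^k𝔮_k`: `n_k ≤ 𝔅₀·η^k·(r̃_{k0} + … + r̃_{kk}x^k)` with NESTED explicit coefficients (abbreviation hypotheses; top coefficient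
  `r̃₃₃ = 2G₃/G₀`), all nonnegative.

Pure real algebra; no definitions, no sorry.  Nothing asserts superconductivity. [cite: BenfattoGiulianiMastropietro2006, §3 (3.2)–(3.8)]
-/

noncomputable section

namespace Summit.HubbardSuperconductivity.HubbardSuperconductivity.Theorems.TorusFourierL2

set_option linter.dupNamespace false -- summit = problem name (single-conjunct summit), D-0017

/-! ### §4 Space differences relative to the amplitude, in scale form -/

set_option maxHeartbeats 1600000 in
/-- **Space Leibniz bounds in relative scale form** (see the module docstring): from the instance's Leibniz bounds `n_k ≤ Σ binom 𝔅_j q_{k−j}` with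
exact brackets, the inequality line data of the scale class (§1) and the co-factor's scale-form jets `q_k ≤ η^k𝔮_k` (§2):
`n_k ≤ 𝔅₀·η^k·(r̃_{k0} + … + r̃_{kk}x^k)` with the displayed nested coefficients, all nonnegative. [cite: BenfattoGiulianiMastropietro2006, §3 (3.2)–(3.8)] -/
theorem incrPair_space_rel_scale_le
    {Λ E₀ t ε₂ ε₃₀ ε₃₁ G₀ G₁ G₂ G₃ η x κ C₁ C₂ C₃ C₄ E₁ E₂ E₃ P₀ P₁ P₂ P₃ D₁ D₂ D₃ W₀ W₁ W₂ W₃ B₀ B₁ B₂ B₃ q₁ q₂ q₃ 𝔮₁ 𝔮₂ 𝔮₃₀ 𝔮₃₁ n₁ n₂ n₃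
      d₁ w₁ d₂ w₂ d₃₀ d₃₁ w₃₀ w₃₁ o₁₀ o₁₁ o₂₀ o₂₁ o₂₂ o₃₀ o₃₁ o₃₂ o₃₃ R₁₀ R₁₁ R₂₀ R₂₁ R₂₂ R₃₀ R₃₁ R₃₂ R₃₃ r₁₀ r₁₁ r₂₀ r₂₁ r₂₂ r₃₀ r₃₁ r₃₂ r₃₃ : ℝ}
    (hΛ : 0 < Λ) (hE₀l : Λ ≤ E₀) (hE₀u : E₀ ≤ 2 * Λ) (ht : 0 ≤ t) (hε₂ : 0 ≤ ε₂) (hε₃₀ : 0 ≤ ε₃₀) (hε₃₁ : 0 ≤ ε₃₁)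
    (hG₀ : 0 < G₀) (hG₁ : 0 ≤ G₁) (hG₂ : 0 ≤ G₂) (hG₃ : 0 ≤ G₃) (hη : 0 ≤ η) (hx : 1 ≤ x) (hκ : 0 ≤ κ) (hC₁0 : 0 ≤ C₁)
    (hE₁0 : 0 ≤ E₁) (hE₂0 : 0 ≤ E₂) (hE₃0 : 0 ≤ E₃) (hP₁0 : 0 ≤ P₁) (hP₂0 : 0 ≤ P₂) (hP₃0 : 0 ≤ P₃)
    (hE₁ : E₁ ≤ t * η) (hE₂ : E₂ ≤ ε₂ * η ^ 2) (hE₃ : E₃ ≤ (ε₃₀ + ε₃₁ * x) * η ^ 3)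
    (hP₀ : P₀ = G₀ / x ^ 2) (hP₁ : P₁ ≤ G₁ / x * η) (hP₂ : P₂ ≤ G₂ * η ^ 2) (hP₃ : P₃ ≤ G₃ * x * η ^ 3)
    (hC₂ : C₂ = κ * C₁) (hC₃ : C₃ = κ ^ 2 * C₁) (hC₄ : C₄ = κ ^ 3 * C₁)
    (hD₁ : D₁ = 2 * E₀ * E₁) (hD₂ : D₂ = 2 * (E₁ ^ 2 + E₀ * E₂)) (hD₃ : D₃ = 2 * (3 * E₁ * E₂ + E₀ * E₃))
    (hW₀ : W₀ = P₀ * (2 * E₀ + P₀)) (hW₁ : W₁ = 2 * (E₁ * P₀ + E₀ * P₁ + P₀ * P₁))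
    (hW₂ : W₂ = 2 * (E₂ * P₀ + 2 * E₁ * P₁ + E₀ * P₂ + P₁ ^ 2 + P₀ * P₂))
    (hW₃ : W₃ = 2 * (E₃ * P₀ + 3 * E₂ * P₁ + 3 * E₁ * P₂ + E₀ * P₃ + 3 * P₁ * P₂ + P₀ * P₃))
    (hB₀ : B₀ = C₁ * W₀) (hB₁ : B₁ = C₂ * W₀ * (D₁ + W₁) + C₁ * W₁)
    (hB₂ : B₂ = C₃ * W₀ * (D₁ + W₁) ^ 2 + C₂ * (W₁ * (2 * D₁ + W₁)) + (C₂ * W₀ * (D₂ + W₂) + C₁ * W₂))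
    (hB₃ : B₃ = C₄ * W₀ * (D₁ + W₁) ^ 3 + C₃ * (W₁ * (3 * D₁ ^ 2 + 3 * D₁ * W₁ + W₁ ^ 2)) +
        3 * (C₃ * W₀ * ((D₁ + W₁) * (D₂ + W₂)) + C₂ * (D₁ * W₂ + W₁ * D₂ + W₁ * W₂)) + (C₂ * W₀ * (D₃ + W₃) + C₁ * W₃))
    -- the instance's Leibniz bounds and the co-factor's scale-form jets
    (h₁ : n₁ ≤ B₁ * 1 + B₀ * q₁) (h₂ : n₂ ≤ B₂ * 1 + 2 * (B₁ * q₁) + B₀ * q₂) (h₃ : n₃ ≤ B₃ * 1 + 3 * (B₂ * q₁) + 3 * (B₁ * q₂) + B₀ * q₃)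
    (hq₁0 : 0 ≤ q₁) (hq₂0 : 0 ≤ q₂) (hq₁ : q₁ ≤ η * 𝔮₁) (hq₂ : q₂ ≤ η ^ 2 * 𝔮₂) (hq₃ : q₃ ≤ η ^ 3 * (𝔮₃₀ + 𝔮₃₁ * x))
    (h𝔮₁ : 0 ≤ 𝔮₁) (h𝔮₂ : 0 ≤ 𝔮₂) (h𝔮₃₀ : 0 ≤ 𝔮₃₀) (h𝔮₃₁ : 0 ≤ 𝔮₃₁)
    -- the coefficient names
    (hd₁ : d₁ = 4 * Λ * t) (hw₁ : w₁ = 2 * (t * G₀ + 2 * Λ * G₁ + G₀ * G₁)) (hd₂ : d₂ = 2 * (t ^ 2 + 2 * Λ * ε₂))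
    (hw₂ : w₂ = 2 * (ε₂ * G₀ + 2 * t * G₁ + 2 * Λ * G₂ + G₁ ^ 2 + G₀ * G₂))
    (hd₃₀ : d₃₀ = 2 * (3 * t * ε₂ + 2 * Λ * ε₃₀)) (hd₃₁ : d₃₁ = 4 * Λ * ε₃₁)
    (hw₃₀ : w₃₀ = 2 * (ε₃₀ * G₀ + ε₃₁ * G₀ + 3 * ε₂ * G₁ + 3 * t * G₂ + 3 * G₁ * G₂ + G₀ * G₃)) (hw₃₁ : w₃₁ = 4 * Λ * G₃)
    (ho₁₀ : o₁₀ = t / Λ) (ho₁₁ : o₁₁ = 2 * G₁ / G₀) (ho₂₀ : o₂₀ = ε₂ / Λ + G₁ ^ 2 / (Λ * G₀)) (ho₂₁ : o₂₁ = 2 * t * G₁ / (Λ * G₀)) (ho₂₂ : o₂₂ = 2 * G₂ / G₀)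
    (ho₃₀ : o₃₀ = ε₃₀ / Λ) (ho₃₁ : o₃₁ = ε₃₁ / Λ + 3 * ε₂ * G₁ / (Λ * G₀) + 3 * G₁ * G₂ / (Λ * G₀)) (ho₃₂ : o₃₂ = 3 * t * G₂ / (Λ * G₀))
    (ho₃₃ : o₃₃ = 2 * G₃ / G₀)
    (hR₁₀ : R₁₀ = κ * (d₁ + w₁) + o₁₀) (hR₁₁ : R₁₁ = o₁₁)
    (hR₂₀ : R₂₀ = κ ^ 2 * (d₁ + w₁) ^ 2 + κ * (o₁₀ * (2 * d₁ + w₁)) + κ * (d₂ + w₂) + o₂₀) (hR₂₁ : R₂₁ = κ * (o₁₁ * (2 * d₁ + w₁)) + o₂₁)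
    (hR₂₂ : R₂₂ = o₂₂)
    (hR₃₀ : R₃₀ = κ ^ 3 * (d₁ + w₁) ^ 3 + κ ^ 2 * (o₁₀ * (3 * d₁ ^ 2 + 3 * d₁ * w₁ + w₁ ^ 2)) +
      3 * (κ ^ 2 * ((d₁ + w₁) * (d₂ + w₂)) + κ * (d₁ * o₂₀ + o₁₀ * d₂ + o₁₀ * w₂)) + κ * (d₃₀ + w₃₀) + o₃₀)
    (hR₃₁ : R₃₁ = κ ^ 2 * (o₁₁ * (3 * d₁ ^ 2 + 3 * d₁ * w₁ + w₁ ^ 2)) + 3 * (κ * (d₁ * o₂₁ + o₁₁ * d₂ + o₁₁ * w₂)) + κ * (d₃₁ + w₃₁) + o₃₁)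
    (hR₃₂ : R₃₂ = 3 * (κ * (d₁ * o₂₂)) + o₃₂) (hR₃₃ : R₃₃ = o₃₃)
    (hr₁₀ : r₁₀ = R₁₀ + 𝔮₁) (hr₁₁ : r₁₁ = R₁₁) (hr₂₀ : r₂₀ = R₂₀ + 2 * R₁₀ * 𝔮₁ + 𝔮₂) (hr₂₁ : r₂₁ = R₂₁ + 2 * R₁₁ * 𝔮₁) (hr₂₂ : r₂₂ = R₂₂)
    (hr₃₀ : r₃₀ = R₃₀ + 3 * R₂₀ * 𝔮₁ + 3 * R₁₀ * 𝔮₂ + 𝔮₃₀) (hr₃₁ : r₃₁ = R₃₁ + 3 * R₂₁ * 𝔮₁ + 3 * R₁₁ * 𝔮₂ + 𝔮₃₁)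
    (hr₃₂ : r₃₂ = R₃₂ + 3 * R₂₂ * 𝔮₁) (hr₃₃ : r₃₃ = R₃₃) :
    n₁ ≤ B₀ * (η * (r₁₀ + r₁₁ * x)) ∧ n₂ ≤ B₀ * (η ^ 2 * (r₂₀ + r₂₁ * x + r₂₂ * x ^ 2)) ∧
      n₃ ≤ B₀ * (η ^ 3 * (r₃₀ + r₃₁ * x + r₃₂ * x ^ 2 + r₃₃ * x ^ 3)) ∧
      (0 ≤ r₁₀ ∧ 0 ≤ r₁₁ ∧ 0 ≤ r₂₀ ∧ 0 ≤ r₂₁ ∧ 0 ≤ r₂₂ ∧ 0 ≤ r₃₀ ∧ 0 ≤ r₃₁ ∧ 0 ≤ r₃₂ ∧ 0 ≤ r₃₃) := by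
  have hx0 : 0 < x := lt_of_lt_of_le one_pos hx
  have hE0 : 0 < E₀ := lt_of_lt_of_le hΛ hE₀l
  have hP0pos : 0 < P₀ := by rw [hP₀]; positivity
  have hP0 : 0 ≤ P₀ := hP0pos.le
  have hD₁0 : 0 ≤ D₁ := by rw [hD₁]; positivity
  have hD₂0 : 0 ≤ D₂ := by rw [hD₂]; positivity
  have hW₀0 : 0 ≤ W₀ := by rw [hW₀]; positivity
  have hW₁0 : 0 ≤ W₁ := by rw [hW₁]; positivity
  have hW₂0 : 0 ≤ W₂ := by rw [hW₂]; positivity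
  have hB₀0 : 0 ≤ B₀ := by rw [hB₀]; positivity
  -- step 1: `W_k ≤ ω_kW₀`
  obtain ⟨hrel₁, hrel₂, hrel₃⟩ := incrPair_W_rel_le hE0 hP0pos hE₁0 hE₂0 hE₃0 hP₁0 hP₂0 hP₃0 hW₀ hW₁ hW₂ hW₃
    (ω₁ := E₁ / E₀ + 2 * P₁ / P₀) (ω₂ := E₂ / E₀ + 2 * E₁ * P₁ / (E₀ * P₀) + 2 * P₂ / P₀ + P₁ ^ 2 / (E₀ * P₀))
    (ω₃ := E₃ / E₀ + 3 * E₂ * P₁ / (E₀ * P₀) + 3 * E₁ * P₂ / (E₀ * P₀) + 2 * P₃ / P₀ + 3 * P₁ * P₂ / (E₀ * P₀)) rfl rfl rfl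
  have hω₁0 : 0 ≤ E₁ / E₀ + 2 * P₁ / P₀ := by positivity
  have hω₂0 : 0 ≤ E₂ / E₀ + 2 * E₁ * P₁ / (E₀ * P₀) + 2 * P₂ / P₀ + P₁ ^ 2 / (E₀ * P₀) := by positivity
  -- step 2: `𝔅_k ≤ 𝔅₀ρ_k`
  obtain ⟨bB₁, bB₂, bB₃⟩ := incrPair_B_rel_le hκ hC₁0 hC₂ hC₃ hC₄ hD₁0 hD₂0 hW₁0 hW₂0 hrel₁ hrel₂ hrel₃ hB₀ hB₁ hB₂ hB₃
  -- step 3: the line data in scale form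
  obtain ⟨bD₁, bW₁, bD₂, bW₂, bD₃, bW₃, bω₁, bω₂, bω₃⟩ := incrPair_lineData_scale_le' hΛ hE₀l hE₀u ht hε₂ hε₃₀ hε₃₁ hG₀ hG₁ hG₂ hG₃ hη hx
    hE₁0 hE₂0 hE₃0 hP₁0 hP₂0 hP₃0 hE₁ hE₂ hE₃ hP₀ hP₁ hP₂ hP₃ hD₁ hD₂ hD₃ hW₁ hW₂ hW₃
    (ω₁ := E₁ / E₀ + 2 * P₁ / P₀) (ω₂ := E₂ / E₀ + 2 * E₁ * P₁ / (E₀ * P₀) + 2 * P₂ / P₀ + P₁ ^ 2 / (E₀ * P₀))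
    (ω₃ := E₃ / E₀ + 3 * E₂ * P₁ / (E₀ * P₀) + 3 * E₁ * P₂ / (E₀ * P₀) + 2 * P₃ / P₀ + 3 * P₁ * P₂ / (E₀ * P₀)) rfl rfl rfl
  -- step 4: the relative sizes in scale form
  obtain ⟨bρ₁, bρ₂, bρ₃⟩ := incrPair_relJets_scale_le (d₁ := 4 * Λ * t) (w₁ := 2 * (t * G₀ + 2 * Λ * G₁ + G₀ * G₁)) (d₂ := 2 * (t ^ 2 + 2 * Λ * ε₂))
    (w₂ := 2 * (ε₂ * G₀ + 2 * t * G₁ + 2 * Λ * G₂ + G₁ ^ 2 + G₀ * G₂)) (d₃ := 2 * (3 * t * ε₂ + 2 * Λ * ε₃₀) + 4 * Λ * ε₃₁ * x)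
    (w₃ := 2 * (ε₃₀ * G₀ + ε₃₁ * G₀ + 3 * ε₂ * G₁ + 3 * t * G₂ + 3 * G₁ * G₂ + G₀ * G₃) + 4 * Λ * G₃ * x)
    (o₁ := t / Λ + 2 * G₁ / G₀ * x) (o₂ := (ε₂ / Λ + G₁ ^ 2 / (Λ * G₀)) + 2 * t * G₁ / (Λ * G₀) * x + 2 * G₂ / G₀ * x ^ 2)
    (o₃ := ε₃₀ / Λ + (ε₃₁ / Λ + 3 * ε₂ * G₁ / (Λ * G₀) + 3 * G₁ * G₂ / (Λ * G₀)) * x + 3 * t * G₂ / (Λ * G₀) * x ^ 2 + 2 * G₃ / G₀ * x ^ 3)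
    hκ hD₁0 hD₂0 hW₁0 hW₂0 hω₁0 hω₂0 bD₁ bD₂ bD₃ bW₁ bW₂ bW₃ (bω₁.trans_eq (mul_comm _ _)) (bω₂.trans_eq (mul_comm _ _)) (bω₃.trans_eq (mul_comm _ _))
  -- nonnegativity of the coefficient names
  have hd₁0 : 0 ≤ d₁ := by rw [hd₁]; positivity
  have hw₁0 : 0 ≤ w₁ := by rw [hw₁]; positivity
  have hd₂0 : 0 ≤ d₂ := by rw [hd₂]; positivity
  have hw₂0 : 0 ≤ w₂ := by rw [hw₂]; positivity
  have hd₃₀0 : 0 ≤ d₃₀ := by rw [hd₃₀]; positivity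
  have hd₃₁0 : 0 ≤ d₃₁ := by rw [hd₃₁]; positivity
  have hw₃₀0 : 0 ≤ w₃₀ := by rw [hw₃₀]; positivity
  have hw₃₁0 : 0 ≤ w₃₁ := by rw [hw₃₁]; positivity
  have ho₁₀0 : 0 ≤ o₁₀ := by rw [ho₁₀]; positivity
  have ho₁₁0 : 0 ≤ o₁₁ := by rw [ho₁₁]; positivity
  have ho₂₀0 : 0 ≤ o₂₀ := by rw [ho₂₀]; positivity
  have ho₂₁0 : 0 ≤ o₂₁ := by rw [ho₂₁]; positivity
  have ho₂₂0 : 0 ≤ o₂₂ := by rw [ho₂₂]; positivity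
  have ho₃₀0 : 0 ≤ o₃₀ := by rw [ho₃₀]; positivity
  have ho₃₁0 : 0 ≤ o₃₁ := by rw [ho₃₁]; positivity
  have ho₃₂0 : 0 ≤ o₃₂ := by rw [ho₃₂]; positivity
  have ho₃₃0 : 0 ≤ o₃₃ := by rw [ho₃₃]; positivity
  have hR₁₀0 : 0 ≤ R₁₀ := by rw [hR₁₀]; positivity
  have hR₁₁0 : 0 ≤ R₁₁ := by rw [hR₁₁]; positivity
  have hR₂₀0 : 0 ≤ R₂₀ := by rw [hR₂₀]; positivity
  have hR₂₁0 : 0 ≤ R₂₁ := by rw [hR₂₁]; positivity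
  have hR₂₂0 : 0 ≤ R₂₂ := by rw [hR₂₂]; positivity
  have hR₃₀0 : 0 ≤ R₃₀ := by rw [hR₃₀]; positivity
  have hR₃₁0 : 0 ≤ R₃₁ := by rw [hR₃₁]; positivity
  have hR₃₂0 : 0 ≤ R₃₂ := by rw [hR₃₂]; positivity
  have hR₃₃0 : 0 ≤ R₃₃ := by rw [hR₃₃]; positivity
  have hr₁₀0 : 0 ≤ r₁₀ := by rw [hr₁₀]; positivity
  have hr₁₁0 : 0 ≤ r₁₁ := by rw [hr₁₁]; positivity
  have hr₂₀0 : 0 ≤ r₂₀ := by rw [hr₂₀]; positivity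
  have hr₂₁0 : 0 ≤ r₂₁ := by rw [hr₂₁]; positivity
  have hr₂₂0 : 0 ≤ r₂₂ := by rw [hr₂₂]; positivity
  have hr₃₀0 : 0 ≤ r₃₀ := by rw [hr₃₀]; positivity
  have hr₃₁0 : 0 ≤ r₃₁ := by rw [hr₃₁]; positivity
  have hr₃₂0 : 0 ≤ r₃₂ := by rw [hr₃₂]; positivity
  have hr₃₃0 : 0 ≤ r₃₃ := by rw [hr₃₃]; positivity
  -- the polynomials `R_k(x)`
  have eR₁ : κ * (4 * Λ * t + 2 * (t * G₀ + 2 * Λ * G₁ + G₀ * G₁)) + (t / Λ + 2 * G₁ / G₀ * x) = R₁₀ + R₁₁ * x := by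
    rw [hR₁₀, hR₁₁, hd₁, hw₁, ho₁₀, ho₁₁]; ring
  have eR₂ : κ ^ 2 * (4 * Λ * t + 2 * (t * G₀ + 2 * Λ * G₁ + G₀ * G₁)) ^ 2 +
        κ * ((t / Λ + 2 * G₁ / G₀ * x) * (2 * (4 * Λ * t) + 2 * (t * G₀ + 2 * Λ * G₁ + G₀ * G₁))) +
        κ * (2 * (t ^ 2 + 2 * Λ * ε₂) + 2 * (ε₂ * G₀ + 2 * t * G₁ + 2 * Λ * G₂ + G₁ ^ 2 + G₀ * G₂)) +
        ((ε₂ / Λ + G₁ ^ 2 / (Λ * G₀)) + 2 * t * G₁ / (Λ * G₀) * x + 2 * G₂ / G₀ * x ^ 2) = R₂₀ + R₂₁ * x + R₂₂ * x ^ 2 := by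
    rw [hR₂₀, hR₂₁, hR₂₂, hd₁, hw₁, hd₂, hw₂, ho₁₀, ho₁₁, ho₂₀, ho₂₁, ho₂₂]; ring
  have eR₃ : κ ^ 3 * (4 * Λ * t + 2 * (t * G₀ + 2 * Λ * G₁ + G₀ * G₁)) ^ 3 +
        κ ^ 2 * ((t / Λ + 2 * G₁ / G₀ * x) * (3 * (4 * Λ * t) ^ 2 + 3 * (4 * Λ * t) * (2 * (t * G₀ + 2 * Λ * G₁ + G₀ * G₁)) +
          (2 * (t * G₀ + 2 * Λ * G₁ + G₀ * G₁)) ^ 2)) +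
        3 * (κ ^ 2 * ((4 * Λ * t + 2 * (t * G₀ + 2 * Λ * G₁ + G₀ * G₁)) * (2 * (t ^ 2 + 2 * Λ * ε₂) + 2 * (ε₂ * G₀ + 2 * t * G₁ + 2 * Λ * G₂ + G₁ ^ 2 + G₀ * G₂))) +
          κ * ((4 * Λ * t) * ((ε₂ / Λ + G₁ ^ 2 / (Λ * G₀)) + 2 * t * G₁ / (Λ * G₀) * x + 2 * G₂ / G₀ * x ^ 2) +
            (t / Λ + 2 * G₁ / G₀ * x) * (2 * (t ^ 2 + 2 * Λ * ε₂)) + (t / Λ + 2 * G₁ / G₀ * x) * (2 * (ε₂ * G₀ + 2 * t * G₁ + 2 * Λ * G₂ + G₁ ^ 2 + G₀ * G₂)))) +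
        κ * ((2 * (3 * t * ε₂ + 2 * Λ * ε₃₀) + 4 * Λ * ε₃₁ * x) + (2 * (ε₃₀ * G₀ + ε₃₁ * G₀ + 3 * ε₂ * G₁ + 3 * t * G₂ + 3 * G₁ * G₂ + G₀ * G₃) + 4 * Λ * G₃ * x)) +
        (ε₃₀ / Λ + (ε₃₁ / Λ + 3 * ε₂ * G₁ / (Λ * G₀) + 3 * G₁ * G₂ / (Λ * G₀)) * x + 3 * t * G₂ / (Λ * G₀) * x ^ 2 + 2 * G₃ / G₀ * x ^ 3) =
        R₃₀ + R₃₁ * x + R₃₂ * x ^ 2 + R₃₃ * x ^ 3 := by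
    rw [hR₃₀, hR₃₁, hR₃₂, hR₃₃, hd₁, hw₁, hd₂, hw₂, hd₃₀, hd₃₁, hw₃₀, hw₃₁, ho₁₀, ho₁₁, ho₂₀, ho₂₁, ho₂₂, ho₃₀, ho₃₁, ho₃₂, ho₃₃]; ring
  rw [eR₁] at bρ₁; rw [eR₂] at bρ₂; rw [eR₃] at bρ₃
  have hR₁x : 0 ≤ R₁₀ + R₁₁ * x := by positivity
  have hR₂x : 0 ≤ R₂₀ + R₂₁ * x + R₂₂ * x ^ 2 := by positivity
  -- step 5: combine with the co-factor jets
  have cB₁ : B₁ ≤ B₀ * (η * (R₁₀ + R₁₁ * x)) := bB₁.trans (mul_le_mul_of_nonneg_left bρ₁ hB₀0)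
  have cB₂ : B₂ ≤ B₀ * (η ^ 2 * (R₂₀ + R₂₁ * x + R₂₂ * x ^ 2)) := bB₂.trans (mul_le_mul_of_nonneg_left bρ₂ hB₀0)
  have cB₃ : B₃ ≤ B₀ * (η ^ 3 * (R₃₀ + R₃₁ * x + R₃₂ * x ^ 2 + R₃₃ * x ^ 3)) := bB₃.trans (mul_le_mul_of_nonneg_left bρ₃ hB₀0)
  have hB₁0 : 0 ≤ B₁ := by rw [hB₁, hC₂]; positivity
  have hB₂0 : 0 ≤ B₂ := by rw [hB₂, hC₂, hC₃]; positivity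
  have p11 : B₁ * q₁ ≤ B₀ * (η * (R₁₀ + R₁₁ * x)) * (η * 𝔮₁) := mul_le_mul cB₁ hq₁ hq₁0 (by positivity)
  have p21 : B₂ * q₁ ≤ B₀ * (η ^ 2 * (R₂₀ + R₂₁ * x + R₂₂ * x ^ 2)) * (η * 𝔮₁) := mul_le_mul cB₂ hq₁ hq₁0 (by positivity)
  have p12 : B₁ * q₂ ≤ B₀ * (η * (R₁₀ + R₁₁ * x)) * (η ^ 2 * 𝔮₂) := mul_le_mul cB₁ hq₂ hq₂0 (by positivity)
  have p01 : B₀ * q₁ ≤ B₀ * (η * 𝔮₁) := mul_le_mul_of_nonneg_left hq₁ hB₀0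
  have p02 : B₀ * q₂ ≤ B₀ * (η ^ 2 * 𝔮₂) := mul_le_mul_of_nonneg_left hq₂ hB₀0
  have p03 : B₀ * q₃ ≤ B₀ * (η ^ 3 * (𝔮₃₀ + 𝔮₃₁ * x)) := mul_le_mul_of_nonneg_left hq₃ hB₀0
  refine ⟨?_, ?_, ?_, ⟨hr₁₀0, hr₁₁0, hr₂₀0, hr₂₁0, hr₂₂0, hr₃₀0, hr₃₁0, hr₃₂0, hr₃₃0⟩⟩
  · calc n₁ ≤ B₁ * 1 + B₀ * q₁ := h₁
      _ ≤ B₀ * (η * (R₁₀ + R₁₁ * x)) * 1 + B₀ * (η * 𝔮₁) := by linarith only [cB₁, p01]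
      _ = B₀ * (η * (r₁₀ + r₁₁ * x)) := by rw [hr₁₀, hr₁₁]; ring
  · calc n₂ ≤ B₂ * 1 + 2 * (B₁ * q₁) + B₀ * q₂ := h₂
      _ ≤ B₀ * (η ^ 2 * (R₂₀ + R₂₁ * x + R₂₂ * x ^ 2)) * 1 + 2 * (B₀ * (η * (R₁₀ + R₁₁ * x)) * (η * 𝔮₁)) + B₀ * (η ^ 2 * 𝔮₂) := by
          linarith only [cB₂, p11, p02]
      _ = B₀ * (η ^ 2 * (r₂₀ + r₂₁ * x + r₂₂ * x ^ 2)) := by rw [hr₂₀, hr₂₁, hr₂₂]; ring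
  · calc n₃ ≤ B₃ * 1 + 3 * (B₂ * q₁) + 3 * (B₁ * q₂) + B₀ * q₃ := h₃
      _ ≤ B₀ * (η ^ 3 * (R₃₀ + R₃₁ * x + R₃₂ * x ^ 2 + R₃₃ * x ^ 3)) * 1 + 3 * (B₀ * (η ^ 2 * (R₂₀ + R₂₁ * x + R₂₂ * x ^ 2)) * (η * 𝔮₁)) +
            3 * (B₀ * (η * (R₁₀ + R₁₁ * x)) * (η ^ 2 * 𝔮₂)) + B₀ * (η ^ 3 * (𝔮₃₀ + 𝔮₃₁ * x)) := by
          linarith only [cB₃, p21, p12, p03]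
      _ = B₀ * (η ^ 3 * (r₃₀ + r₃₁ * x + r₃₂ * x ^ 2 + r₃₃ * x ^ 3)) := by rw [hr₃₀, hr₃₁, hr₃₂, hr₃₃]; ring

end Summit.HubbardSuperconductivity.HubbardSuperconductivity.Theorems.TorusFourierL2

end
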